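import Mathlib.Analysis.SpecialFunctions.Pow.Real
import Mathlib.Analysis.SpecialFunctions.Exp
import Mathlib.Analysis.SpecialFunctions.Log.Basic
import HarnessLib

/-!
# XXXIa: first-order expansion of the odd-head scalars 
(cell `pub-ising3x`, seat boot-1 gen 15/16; the MERGED-2 (first-order) odd-head test chain, module XXXIa)

HONEST FRAMING: lottery ticket; floor = tightest certified 3D Ising CFT bounds; no exact-solution
claim without a proof. Island framing: certified exclusion region at stated derivative order and
assumptions; not a determination of the 3D Ising critical exponents beyond that.

[folklore]
-/

namespace Summit.CriticalPhenomena.Ising3D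

namespace HeadScalars2


open Real

/-- `(½)^t = exp (−t · log 2)`. [folklore] -/
theorem half_rpow_eq_exp (t : ℝ) : (1 / 2 : ℝ) ^ t = Real.exp (-(t * Real.log 2)) := by
  rw [Real.rpow_def_of_pos (by norm_num : (0 : ℝ) < 1 / 2)]
  congr 1
  rw [one_div, Real.log_inv]; ring

/-- **First-order expansion of `(½)^{t₀ + d}` with an absolute second-order bound.** [folklore] -/
theorem half_rpow_first_order (t0 : ℝ) {d W : ℝ} (hd : |d| ≤ W) (hWln : W * Real.log 2 ≤ 1) :
    |(1 / 2 : ℝ) ^ (t0 + d) - (1 / 2 : ℝ) ^ t0 * (1 - Real.log 2 * d)| ≤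
      (1 / 2 : ℝ) ^ t0 * ((Real.log 2) ^ 2 * W ^ 2) := by
  have hK : 0 < (1 / 2 : ℝ) ^ t0 := Real.rpow_pos_of_pos (by norm_num) t0
  have hl2 : 0 < Real.log 2 := Real.log_pos (by norm_num)
  have hW : 0 ≤ W := le_trans (abs_nonneg d) hd
  set u : ℝ := -(d * Real.log 2) with hu
  have hu1 : |u| ≤ 1 := by
    rw [hu, abs_neg, abs_mul, abs_of_pos hl2]
    calc |d| * Real.log 2 ≤ W * Real.log 2 := mul_le_mul_of_nonneg_right hd hl2.le
      _ ≤ 1 := hWln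
  have hsplit : (1 / 2 : ℝ) ^ (t0 + d) = (1 / 2 : ℝ) ^ t0 * Real.exp u := by
    rw [Real.rpow_add (by norm_num : (0 : ℝ) < 1 / 2), half_rpow_eq_exp d, hu]
  have hexp := Real.abs_exp_sub_one_sub_id_le hu1
  have e : (1 / 2 : ℝ) ^ (t0 + d) - (1 / 2 : ℝ) ^ t0 * (1 - Real.log 2 * d) =
      (1 / 2 : ℝ) ^ t0 * (Real.exp u - 1 - u) := by rw [hsplit, hu]; ring
  rw [e, abs_mul, abs_of_pos hK]
  refine mul_le_mul_of_nonneg_left ?_ hK.le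
  calc |Real.exp u - 1 - u| ≤ u ^ 2 := hexp
    _ = (d * Real.log 2) ^ 2 := by rw [hu]; ring
    _ = d ^ 2 * (Real.log 2) ^ 2 := by ring
    _ ≤ W ^ 2 * (Real.log 2) ^ 2 := by
        have : d ^ 2 ≤ W ^ 2 := by
          have h1 : |d| ^ 2 ≤ W ^ 2 := pow_le_pow_left₀ (abs_nonneg d) hd 2
          simpa [sq_abs] using h1
        exact mul_le_mul_of_nonneg_right this (by positivity)
    _ = (Real.log 2) ^ 2 * W ^ 2 := by ring

/-- The two-variable form used by the test: `κ(x, y) = K·(½)^{(y − x)}`-type scalars with `|x| ≤ Wσ`, `|y| ≤ Wε`, `W = max Wσ Wε`: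
`|(½)^{t₀ + (y − x)} − K(1 − ln 2·(y − x))| ≤ K (ln 2)² (2W)² = 4 K (ln 2)² W²`. [folklore] -/
theorem half_rpow_first_order_xy (t0 : ℝ) {x y Ws We W : ℝ} (hx : |x| ≤ Ws) (hy : |y| ≤ We) (hWs : Ws ≤ W) (hWe : We ≤ W)
    (hWln : 2 * W * Real.log 2 ≤ 1) :
    |(1 / 2 : ℝ) ^ (t0 + (y - x)) - (1 / 2 : ℝ) ^ t0 * (1 - Real.log 2 * (y - x))| ≤
      (1 / 2 : ℝ) ^ t0 * (4 * (Real.log 2) ^ 2 * W ^ 2) := by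
  have hd : |y - x| ≤ 2 * W := by
    calc |y - x| ≤ |y| + |x| := abs_sub _ _
      _ ≤ We + Ws := add_le_add hy hx
      _ ≤ 2 * W := by linarith
  have h := half_rpow_first_order t0 hd (by linarith)
  calc _ ≤ (1 / 2 : ℝ) ^ t0 * ((Real.log 2) ^ 2 * (2 * W) ^ 2) := h
    _ = (1 / 2 : ℝ) ^ t0 * (4 * (Real.log 2) ^ 2 * W ^ 2) := by ring

/-! ### The per-family algebraic core of `term2_sound` (LEAN-PLAN item 2): value − (zeroth + first order) is second order, with the
### exact constant structure of `HeadParts2.famRem` -/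

/-- `|e^u − 1 − u| ≤ u²` for `|u| ≤ 1` (Mathlib), restated. [folklore] -/
theorem abs_exp_sub_one_sub_le {u : ℝ} (hu : |u| ≤ 1) : |Real.exp u - 1 - u| ≤ u ^ 2 := Real.abs_exp_sub_one_sub_id_le hu

/-- **Per-family decomposition bound.** For a scalar `s = s₀·e^u` (`|u| ≤ U ≤ 1`), a literal `L = l₀ + l₁' + l₂'` (think `l₁' = δ l₁`,
`l₂' = δ² l₂`) and an entry `E = e₀ + e₁' + e₂'` (think `e₁' = τ e₁`, `e₂' = τ² e₂`):
`|s·L·E − (s₀ l₀ e₀ + s₀ (l₁' e₀ + l₀ e₁') + s₀ u l₀ e₀)| ≤ |s₀|·(Q + U·(|l₁'||e₀| + |l₀||e₁'| + Q) + U²·(|l₀|+|l₁'|+|l₂'|)(|e₀|+|e₁'|+|e₂'|))`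
with `Q = |l₀||e₂'| + |l₁'|(|e₁'| + |e₂'|) + |l₂'|(|e₀| + |e₁'| + |e₂'|)` — literally the shape of `HeadParts2.famRem` (`varies = true`).
[folklore] -/
theorem fam_decomp_bound {s0 u U l0 l1 l2 e0 e1 e2 : ℝ} (hu : |u| ≤ U) (hU : U ≤ 1) :
    |s0 * Real.exp u * (l0 + l1 + l2) * (e0 + e1 + e2) - (s0 * l0 * e0 + s0 * (l1 * e0 + l0 * e1) + s0 * u * l0 * e0)| ≤
      |s0| * ((|l0| * |e2| + |l1| * (|e1| + |e2|) + |l2| * (|e0| + |e1| + |e2|)) +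
        U * (|l1| * |e0| + |l0| * |e1| + (|l0| * |e2| + |l1| * (|e1| + |e2|) + |l2| * (|e0| + |e1| + |e2|))) +
        U ^ 2 * ((|l0| + |l1| + |l2|) * (|e0| + |e1| + |e2|))) := by
  have hU0 : 0 ≤ U := le_trans (abs_nonneg u) hu
  set r : ℝ := Real.exp u - 1 - u with hr
  have hrb : |r| ≤ U ^ 2 := le_trans (abs_exp_sub_one_sub_le (le_trans hu hU)) (by
    have := pow_le_pow_left₀ (abs_nonneg u) hu 2; simpa [sq_abs] using this)
  set Q : ℝ := l0 * e2 + l1 * (e1 + e2) + l2 * (e0 + e1 + e2) with hQ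
  -- exact algebraic decomposition
  have e : s0 * Real.exp u * (l0 + l1 + l2) * (e0 + e1 + e2) - (s0 * l0 * e0 + s0 * (l1 * e0 + l0 * e1) + s0 * u * l0 * e0) =
      s0 * Q + s0 * u * (l1 * e0 + l0 * e1 + Q) + s0 * r * ((l0 + l1 + l2) * (e0 + e1 + e2)) := by
    have : Real.exp u = 1 + u + r := by rw [hr]; ring
    rw [this, hQ]; ring
  rw [e]
  have hQb : |Q| ≤ |l0| * |e2| + |l1| * (|e1| + |e2|) + |l2| * (|e0| + |e1| + |e2|) := by
    rw [hQ]
    calc |l0 * e2 + l1 * (e1 + e2) + l2 * (e0 + e1 + e2)|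
        ≤ |l0 * e2| + |l1 * (e1 + e2)| + |l2 * (e0 + e1 + e2)| := abs_add_three _ _ _
      _ ≤ _ := by
          rw [abs_mul, abs_mul, abs_mul]
          gcongr
          · exact abs_add_le _ _
          · exact abs_add_three _ _ _
  have h1 : |s0 * Q| ≤ |s0| * (|l0| * |e2| + |l1| * (|e1| + |e2|) + |l2| * (|e0| + |e1| + |e2|)) := by
    rw [abs_mul]; exact mul_le_mul_of_nonneg_left hQb (abs_nonneg _)
  have h2 : |s0 * u * (l1 * e0 + l0 * e1 + Q)| ≤
      |s0| * (U * (|l1| * |e0| + |l0| * |e1| + (|l0| * |e2| + |l1| * (|e1| + |e2|) + |l2| * (|e0| + |e1| + |e2|)))) := by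
    rw [abs_mul, abs_mul, mul_assoc]
    refine mul_le_mul_of_nonneg_left ?_ (abs_nonneg _)
    refine mul_le_mul hu ?_ (abs_nonneg _) hU0
    calc |l1 * e0 + l0 * e1 + Q| ≤ |l1 * e0| + |l0 * e1| + |Q| := abs_add_three _ _ _
      _ ≤ _ := by rw [abs_mul, abs_mul]; gcongr
  have h3 : |s0 * r * ((l0 + l1 + l2) * (e0 + e1 + e2))| ≤ |s0| * (U ^ 2 * ((|l0| + |l1| + |l2|) * (|e0| + |e1| + |e2|))) := by
    rw [abs_mul, abs_mul, mul_assoc]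
    refine mul_le_mul_of_nonneg_left ?_ (abs_nonneg _)
    refine mul_le_mul hrb ?_ (abs_nonneg _) (by positivity)
    rw [abs_mul]
    exact mul_le_mul (abs_add_three _ _ _) (abs_add_three _ _ _) (abs_nonneg _) (by positivity)
  calc _ ≤ |s0 * Q| + |s0 * u * (l1 * e0 + l0 * e1 + Q)| + |s0 * r * ((l0 + l1 + l2) * (e0 + e1 + e2))| := abs_add_three _ _ _
    _ ≤ _ := by nlinarith [h1, h2, h3, abs_nonneg s0]

end HeadScalars2

end Summit.CriticalPhenomena.Ising3D
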